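import Summits.ResolutionOfSingularities.ResolutionOfSingularities.Theorems.EquisingularLiftEquisingularLiftNatHostTransportPointStep
import HarnessLib

/-!
# [OURS · L1 W4.5(b) · EL♮(3) · WIDTH TABLE D5 «IMMATURE HOST» brick Δ2a] AN IMMATURE HYPERSURFACE (pre-letter) THROUGH A POINT STEP

Desk WIDTH TABLE D5 (2026-08-28), engine row D5-2 (res-L1-w45b-stub-4 g11), first half Δ2a.  `--supports stmt-ResolutionOfSingularities-20148`, no claim, counted 0.
AI-produced; NOT a statement of [Hironaka2017]; EL♮(3) is NOT proved here.

WHAT.  res-type-027's F⁺5 ✓ `comap_strictTransformIdeal_eq_of_model` («the special fibre of the strict transform is the strict transform of the special fibre»,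
order-`d` cone packs) fed with K5′'s section frame: for a hypersurface `𝓜` — NOT assumed regular, NOT assumed to contain the section — whose equation `G` at `j x`
has order `≥ a` along the section (`G ∈ (ker s)_{j x}^a`) and whose restriction to the special fibre has order `≤ a` at `x` (`Ḡ ∉ 𝔪_x^{a+1}`): EQUIMULTIPLICITY
(res-L1-w45b-idea-1 R17-2; [Herrmann–Ikeda–Orbanz 1988, App. III (2.2.14)] for the notion), the strict transforms commute with the special-fibre base change.
* `eval_mem_pow_succ_of_map_mk_eq_zero` — a degree-`a` form with coefficients in `(c)` evaluates into `(c)^{a+1}`.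
* ★ `comap_strictTransformIdeal_eq_of_section_of_order` — the exactness `(St_τ 𝓜)·𝒪_{F₂} = St_υ (𝓜·𝒪_{F₁})`.
* ★ `preLetterClauses_strictTransform_of_section` — the four clauses of an immature letter (principal, `O`-flat, `≠ ⊥`, off `Y`) plus the reduced trace
  `𝓘⟨closure (υ⁻¹(M ∖ {x}))⟩` PERSIST (idea-1's `PreLetterDatum` unpacked; currency-neutral until the Defs land).
Degenerate checks: `a = 1` with `𝓜 ≤ ker s` and `V(𝓜)` regular is ✓ HT1 `comap_strictTransformIdeal_host_eq_of_nestedSection` (there `hGbar` is DERIVED from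
regularity; here it is the INPUT); `a = 0` = the letter away from `x` at `j x`.
-/

set_option linter.dupNamespace false
set_option linter.overlappingInstances false

noncomputable section

open CategoryTheory CategoryTheory.Limits AlgebraicGeometry TopologicalSpace Topology IsLocalRing
open Literature.AlgebraicGeometry.Resolution
open AlgebraicGeometry.Scheme.IdealSheafData
open Summit.ResolutionOfSingularities.ResolutionOfSingularities.Theses.EquisingularLift.Split
open Summit.ResolutionOfSingularities.ResolutionOfSingularities.Cruxes.EquisingularLift.StrataSplit

namespace Summit.ResolutionOfSingularities.ResolutionOfSingularities.Cruxes.EquisingularLiftNat.Sections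

section PreLetterPointStep

/-- A homogeneous polynomial of degree `a` all of whose coefficients lie in the ideal `I = (c)` of its arguments evaluates into `I ^ (a + 1)`. [folklore] -/
theorem eval_mem_pow_succ_of_map_mk_eq_zero {A : Type*} [CommRing A] {n a : ℕ} (c : Fin n → A) {Φ : MvPolynomial (Fin n) A}
    (hΦ : Φ.IsHomogeneous a) (h0 : MvPolynomial.map (Ideal.Quotient.mk (Ideal.span (Set.range c))) Φ = 0) :
    MvPolynomial.eval c Φ ∈ Ideal.span (Set.range c) ^ (a + 1) := by
  classical
  rw [Φ.as_sum, map_sum]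
  refine Ideal.sum_mem _ fun m hm => ?_
  rw [MvPolynomial.eval_monomial, pow_succ']
  refine Ideal.mul_mem_mul ?_ ?_
  · -- the coefficient lies in `(c)`
    have h := congr_arg (MvPolynomial.coeff m) h0
    rw [MvPolynomial.coeff_map, MvPolynomial.coeff_zero, Ideal.Quotient.eq_zero_iff_mem] at h
    exact h
  · -- the monomial lies in `(c)^a`
    have hdeg : m.degree = a := by
      have h := hΦ (MvPolynomial.mem_support_iff.mp hm)
      rw [Finsupp.degree_eq_weight_one]
      exact h
    have h1 : MvPolynomial.eval c (MvPolynomial.monomial m (1 : A)) ∈ Ideal.span (Set.range c) ^ a :=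
      (Ideal.mem_span_pow_iff_exists_isHomogeneous c _).mpr ⟨_, MvPolynomial.isHomogeneous_monomial _ hdeg, rfl⟩
    simpa [MvPolynomial.eval_monomial] using h1

variable (O : Type) [CommRing O] [IsDomain O] [IsDiscreteValuationRing O] (k : Type) [Field k] (θ : O →+* k)

/-- **Exactness of ONE IMMATURE hypersurface along a point step (order `a`, equimultiple).**  In the model square of the section blow-up `τ` of `ker s` over the
point blow-up `υ` of `x`, for an ideal sheaf `𝓜` whose stalk at `j x` is generated by an element `G` of ORDER ≥ `a` ALONG THE SECTION (`G ∈ (ker s)_{j x}^a`) whose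
image on the special fibre has order ≤ `a` at `x` (`Ḡ ∉ 𝔪_x^{a+1}` — EQUIMULTIPLICITY: both orders are then `a`): `(St_τ 𝓜)·𝒪_{F₂} = St_υ (𝓜·𝒪_{F₁})`.  This is
res-type-027's F⁺5 ✓ `comap_strictTransformIdeal_eq_of_model` (order-`d` cone packs) fed with a section frame (`exists_sectionFrame_forall_dim_at`), the form of `G`
(`Ideal.mem_span_pow_iff_exists_isHomogeneous`) and `isQuasiRegular_stalkMap_model`; `a = 1` with `𝓜 ≤ ker s` is ✓ `comap_strictTransformIdeal_host_eq_of_nestedSection`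
(HT1). [cite: GortzWedhorn2020, Prop. 13.91] [cite: Matsumura1987, Thm. 14.2] [OURS · L1 W4.5b · WIDTH TABLE D5 brick Δ2a] -/
theorem comap_strictTransformIdeal_eq_of_section_of_order (hθ : Function.Surjective θ) {X' X₁ F₁ F₂ : Scheme.{0}}
    (r' : X' ⟶ Spec (.of O)) [IsSeparated r'] [IsLocallyNoetherian X₁] [IsLocallyNoetherian F₂] [IsIntegral F₁] [IsIntegral F₂]
    [IsLocallyNoetherian F₁] (j : F₁ ⟶ X') (t : F₁ ⟶ Spec (.of k))
    (hsq : IsPullback j t r' (Spec.map (CommRingCat.ofHom θ)))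
    (s : Spec (.of O) ⟶ X') (hs : s ≫ r' = 𝟙 _) (τ : X₁ ⟶ X') (hτ : IsBlowup τ s.ker)
    (υ : F₂ ⟶ F₁) (j₂ : F₂ ⟶ X₁) (hcomm : j₂ ≫ τ = υ ≫ j) (x : F₁) (hx : IsClosed ({x} : Set F₁))
    (hυ : IsBlowup υ (vanishingIdeal ⟨{x}, hx⟩)) (hJ : s.ker.comap j = vanishingIdeal ⟨{x}, hx⟩)
    (hsx : s (closedPoint O) = j x) (hreg : IsRegularLocalRing (X'.presheaf.stalk (j x))) (ϖ : O) (hϖ : Irreducible ϖ)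
    -- the immature hypersurface: order `≥ a` along the section upstairs, order `≤ a` at `x` downstairs
    (𝓜 : X'.IdealSheafData) {G : X'.presheaf.stalk (j x)} (h𝓜G : stalkIdeal 𝓜 (j x) = Ideal.span {G}) {a : ℕ}
    (hGa : G ∈ stalkIdeal s.ker (j x) ^ a) (hGbar : (j.stalkMap x).hom G ∉ maximalIdeal (F₁.presheaf.stalk x) ^ (a + 1)) :
    (strictTransformIdeal τ s.ker 𝓜).comap j₂ = strictTransformIdeal υ (vanishingIdeal ⟨{x}, hx⟩) (𝓜.comap j) := by
  classical
  haveI := hreg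
  have hϖO : ϖ ∈ maximalIdeal O := by rw [hϖ.maximalIdeal_eq]; exact Ideal.mem_span_singleton_self ϖ
  -- (1) a section frame at `j x`
  obtain ⟨n, c, θR, hcI, hc, hdom, -, h𝔪, hϖc, -⟩ := exists_sectionFrame_forall_dim_at O r' s hs (j x) hsx hreg ϖ hϖ
  haveI := hdom
  -- (2) the form of `G` in the frame
  have hGa' : G ∈ Ideal.span (Set.range c) ^ a := by rw [hcI]; exact hGa
  obtain ⟨Φ, hΦd, hΦev⟩ := (Ideal.mem_span_pow_iff_exists_isHomogeneous c G).mp hGa'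
  have hK : stalkIdeal 𝓜 (j x) = Ideal.span {MvPolynomial.eval c Φ} := by rw [hΦev]; exact h𝓜G
  -- (3) the frame downstairs generates `𝔪_x` and is quasi-regular
  have h𝔪d : Ideal.span (Set.range fun i => (j.stalkMap x).hom (c i)) = maximalIdeal (F₁.presheaf.stalk x) :=
    span_stalkMap_eq_maximalIdeal_of_model θ hθ r' j t hsq x ϖ hϖO c h𝔪
  have hcbar : IsQuasiRegular (fun i => (j.stalkMap x).hom (c i)) :=
    isQuasiRegular_stalkMap_model O k θ hθ r' j t hsq x c hc ϖ hϖ hϖc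
  -- (4) equimultiplicity: the form is non-zero modulo the frame downstairs (hence upstairs)
  have hevbar : MvPolynomial.eval (fun i => (j.stalkMap x).hom (c i)) (MvPolynomial.map (j.stalkMap x).hom Φ) = (j.stalkMap x).hom G := by
    rw [← hΦev, ← MvPolynomial.eval₂_eq_eval_map]
    show MvPolynomial.eval₂ (j.stalkMap x).hom _ Φ = (j.stalkMap x).hom (MvPolynomial.eval₂ (RingHom.id _) c Φ)
    rw [MvPolynomial.eval₂_comp_left (j.stalkMap x).hom (RingHom.id _) c Φ, RingHom.comp_id]
    rfl
  have hΦbar : MvPolynomial.map (Ideal.Quotient.mk (Ideal.span (Set.range fun i => (j.stalkMap x).hom (c i))))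
      (MvPolynomial.map (j.stalkMap x).hom Φ) ≠ 0 := by
    intro h0
    apply hGbar
    rw [← hevbar, ← h𝔪d]
    exact eval_mem_pow_succ_of_map_mk_eq_zero _ (hΦd.map _) h0
  have hΦ : MvPolynomial.map (Ideal.Quotient.mk (Ideal.span (Set.range c))) Φ ≠ 0 := by
    intro h0
    apply hGbar
    have h1 : G ∈ Ideal.span (Set.range c) ^ (a + 1) := hΦev ▸ eval_mem_pow_succ_of_map_mk_eq_zero c hΦd h0
    have h2 : (j.stalkMap x).hom G ∈ (Ideal.span (Set.range c) ^ (a + 1)).map (j.stalkMap x).hom := Ideal.mem_map_of_mem _ h1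
    rw [Ideal.map_pow, Ideal.map_span, ← Set.range_comp] at h2
    rw [← h𝔪d]
    exact h2
  -- (5) F⁺5 for `𝓜`
  exact comap_strictTransformIdeal_eq_of_model τ s.ker 𝓜 hτ j υ j₂ hcomm x hx hυ hJ c hcI hc Φ hΦd hΦ hK hcbar hΦbar

/-- **(Δ2a) AN IMMATURE HYPERSURFACE (pre-letter) THROUGH A POINT STEP.**  In K5′'s point-step model square at a stage `(X', σ)` over `q` (section `s` through `j x`,
`τ = Bl_{ker s}`, `υ = Bl_x`, `j₂ ≫ τ = υ ≫ j`), an ideal sheaf `𝓜` with reduced special-fibre trace `𝓘⟨M⟩`, stalkwise principal, `O`-flat, `≠ ⊥` — NO regularity —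
whose equation at `j x` has order `≥ a` along the section and order `≤ a` at `x` on the special fibre (EQUIMULTIPLICITY datum `(G, hGa, hGbar)`) steps to `St_τ 𝓜`
with the same four clauses at the new stage and trace `𝓘⟨closure (υ⁻¹(M ∖ {x}))⟩` (principal = `isPrincipal_stalkIdeal_strictTransformIdeal`, flat = res-L1-w45b-stub-2's
`flat_strictTransform_subschemeι_comp_stage`, trace = `comap_strictTransformIdeal_eq_of_section_of_order`).  The four clauses are idea-1's `PreLetterDatum` unpacked
(currency-neutral until Defs8 lands). [cite: GortzWedhorn2020, Prop. 13.91] [OURS · L1 W4.5b · WIDTH TABLE D5 brick Δ2a] -/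
theorem preLetterClauses_strictTransform_of_section (hθ : Function.Surjective θ) {P X' X₁ F₁ F₂ : Scheme.{0}} (σ : X' ⟶ P) (Y : Set P)
    (q : P ⟶ Spec (.of O)) [IsSeparated (σ ≫ q)] [IsLocallyNoetherian X'] [IsIntegral X'] [IsLocallyNoetherian X₁] [IsLocallyNoetherian F₂]
    [IsIntegral F₁] [IsIntegral F₂] [IsLocallyNoetherian F₁] (hX : Scheme.IsRegular X') (j : F₁ ⟶ X') (t : F₁ ⟶ Spec (.of k))
    (hsq : IsPullback j t (σ ≫ q) (Spec.map (CommRingCat.ofHom θ)))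
    (s : Spec (.of O) ⟶ X') (hs : s ≫ σ ≫ q = 𝟙 _) (hC0 : s.ker ≠ ⊥) (τ : X₁ ⟶ X') (hτ : IsBlowup τ s.ker)
    (υ : F₂ ⟶ F₁) (j₂ : F₂ ⟶ X₁) (hcomm : j₂ ≫ τ = υ ≫ j) (x : F₁) (hx : IsClosed ({x} : Set F₁))
    (hυ : IsBlowup υ (vanishingIdeal ⟨{x}, hx⟩)) (hJ : s.ker.comap j = vanishingIdeal ⟨{x}, hx⟩)
    (hsx : s (closedPoint O) = j x)
    -- the pre-letter and its four clauses
    (𝓜 : X'.IdealSheafData) (h𝓜0 : 𝓜 ≠ ⊥) (h𝓜pr : ∀ z : X', (stalkIdeal 𝓜 z).IsPrincipal) (h𝓜fl : Flat (𝓜.subschemeι ≫ σ ≫ q))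
    (h𝓜off : σ '' (𝓜.support : Set X') ⊆ {p : P | ¬ IsGenericPoint p Y})
    (M : Set F₁) (hM : IsClosed M) (h𝓜tr : 𝓜.comap j = vanishingIdeal ⟨M, hM⟩)
    -- the equimultiplicity datum at `j x`
    {G : X'.presheaf.stalk (j x)} (h𝓜G : stalkIdeal 𝓜 (j x) = Ideal.span {G}) {a : ℕ}
    (hGa : G ∈ stalkIdeal s.ker (j x) ^ a) (hGbar : (j.stalkMap x).hom G ∉ maximalIdeal (F₁.presheaf.stalk x) ^ (a + 1)) :
    (∀ z : X₁, (stalkIdeal (strictTransformIdeal τ s.ker 𝓜) z).IsPrincipal) ∧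
    Flat ((strictTransformIdeal τ s.ker 𝓜).subschemeι ≫ (τ ≫ σ) ≫ q) ∧
    strictTransformIdeal τ s.ker 𝓜 ≠ ⊥ ∧
    (τ ≫ σ) '' ((strictTransformIdeal τ s.ker 𝓜).support : Set X₁) ⊆ {p : P | ¬ IsGenericPoint p Y} ∧
    (strictTransformIdeal τ s.ker 𝓜).comap j₂ = vanishingIdeal ⟨closure (υ ⁻¹' (M \ {x})), isClosed_closure⟩ := by
  have hs' : s ≫ (σ ≫ q) = 𝟙 _ := hs
  obtain ⟨_, hCreg, -, -⟩ := section_isClosedImmersion_and_isRegular_ker O X' (σ ≫ q) s hs'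
  refine ⟨fun z => isPrincipal_stalkIdeal_strictTransformIdeal hX hCreg hτ hC0 𝓜 h𝓜pr z,
    flat_strictTransform_subschemeι_comp_stage O σ q τ s.ker hτ 𝓜 h𝓜fl, strictTransformIdeal_ne_bot hτ hC0 h𝓜0, ?_, ?_⟩
  · rintro _ ⟨z, hz, rfl⟩
    have hz' : τ z ∈ (𝓜.support : Set X') := apply_mem_support_of_mem_support_strictTransformIdeal 𝓜 hz
    exact h𝓜off ⟨τ z, hz', (Scheme.Hom.comp_apply τ σ z).symm⟩
  · obtain ⟨ϖ, hϖ⟩ := IsDiscreteValuationRing.exists_irreducible O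
    rw [comap_strictTransformIdeal_eq_of_section_of_order O k θ hθ (σ ≫ q) j t hsq s hs' τ hτ υ j₂ hcomm x hx hυ hJ hsx (hX (j x)) ϖ hϖ 𝓜 h𝓜G hGa hGbar,
      h𝓜tr, strictTransformIdeal_vanishingIdeal_eq υ _ hυ]
    congr 1

end PreLetterPointStep

end Summit.ResolutionOfSingularities.ResolutionOfSingularities.Cruxes.EquisingularLiftNat.Sections

end
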